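import Summits.QuantumFields.QCD.Theorems.NestedDissectionSeaEarlyCrosserLawMeanCount

/-!
# The mean-count law of early crossers: Jensen law ⇒ mean-count law ⇒ clause (a′)
(line `accretive-coarse-jensen`, crux `EarlyCrosserLaw`, stmt-QuantumFields-13995; lead continuation `c1`)

Sorry-free, definition-free companion of `…EarlyCrosserLawMeanCount.lean` and of the landed reduction
`…EarlyCrosserLawReduction.lean` (p91005).  Write `N_U(s, k) := Σ_f (realSpecCount (M_parent U) (−m_f(k)) +
Σ_{16 children} realSpecCount (M_child U) (−m_f(k)))` for the number (with multiplicity, summed over flavours)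
of EARLY REAL CROSSERS of the corner-`0` window box `s` and its children, `E₊` for the phase-quenched
expectation (ratio of Bochner integrals against `∏_f |det D_W(m_f(k))| dμ_Wilson`, junk-safe).  Proved:

* `meanCount_ratio_le_of_charge` — Markov/monotonicity for the reweighted ratio (pointwise `L·F ≤ G`,
  `E₊ G ≤ δ L` ⇒ `E₊ F ≤ δ`; no integrability of `F` needed);
* `meanCountLaw_of_jensenLaw` — at fixed `(reg, b₀, ℓ, m, R)` the Jensen law (conclusion of the registered
  `stub_jensenDilution`, any radii `r_f > 0`) IMPLIES the MEAN-COUNT LAW `E₊ N_U(s,k) ≤ δ_j`, same `δ`, same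
  `∀ε ∀ᶠk ∀S ∀j ∀s` prefix (grid charge ≥ `log 2 ·` count, `meanCount_log_two_mul_realSpecCount_le_gridSum`);
* `dilution_of_meanCountLaw` — the mean-count law implies clause (a′) of the crux at the same data (a cover
  event has `N ≥ 1`, `meanCount_one_le_realSpecCount`; the count is measurable,
  `meanCount_measurable_realSpecCount`; Markov `outerProb_le_of_charge` with `L = 1`);
* `meanCountLaw_of_jensenDilution` — hence the ∀-reg physics stub `stub_jensenDilution` implies its
  mean-count twin `MeanCountLaw` (same quantifier shell, pins as hypotheses, threshold loss `C`);
* `EarlyCrosserLaw_of_pinnedLine_of_meanCountLaw` (Form A″) and `EarlyCrosserLaw_of_pinnedMeanCount`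
  (Form B″) — the crux BY NAME from the two-sided pin and the mean-count law.

So the implications `JensenDilution ⇒ MeanCountLaw ⇒ (a′)` are kernel-checked: the line's physics debt is
exactly "two-sided parity pin + window-summable MEAN NUMBER of early real crossers of the window cells",
the canonical counting statement (Mohler–Schaefer's `⟨n_neg⟩`-type observable, cell by cell), with the
two-circle Jensen excess as a sufficient analytic handle (linear in the mean eigenvalue measure).
-/

noncomputable section

open scoped BigOperators Matrix ComplexConjugate
open Filter MeasureTheory Polynomial
open Literature.MathematicalPhysics.QuantumLattice Literature.MathematicalPhysics.QuantumFieldTheory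
  Literature.Probability.LatticeModels
open Summit.QuantumFields.QCD.Theses.NestedDissectionSea

namespace Summit.QuantumFields.QCD.Cruxes.EarlyCrosserLaw.AccretiveCoarseJensen

open scoped Classical

/-- **Monotone Markov step for the reweighted ratio** (finite measure, measurable bounded weight `wt ≥ 0`,
measurable bounded `G ≥ 0`): if `L · F ≤ G` pointwise with `L > 0` and the reweighted mean of `G` is `≤ δ L`,
then the reweighted mean of `F` is `≤ δ` (Bochner conventions; `F` need not be integrable). [folklore] -/
theorem meanCount_ratio_le_of_charge {X : Type*} [MeasurableSpace X] (μ : Measure X) [IsFiniteMeasure μ]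
    (wt F G : X → ℝ) (hwt : Measurable wt) (hwt0 : ∀ U, 0 ≤ wt U) (Cw : ℝ) (hwtC : ∀ U, wt U ≤ Cw)
    (hG : Measurable G) (hG0 : ∀ U, 0 ≤ G U) (B : ℝ) (hGB : ∀ U, G U ≤ B)
    (L : ℝ) (hL : 0 < L) (hFG : ∀ U, L * F U ≤ G U) (δ : ℝ)
    (hbound : (∫ U, G U * wt U ∂μ) / (∫ U, wt U ∂μ) ≤ δ * L) :
    (∫ U, F U * wt U ∂μ) / (∫ U, wt U ∂μ) ≤ δ := by
  have hGwt_int : Integrable (fun U => G U * wt U) μ := by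
    refine Integrable.of_bound (hG.mul hwt).aestronglyMeasurable (B * Cw)
      (Eventually.of_forall fun U => ?_)
    rw [Real.norm_eq_abs, abs_of_nonneg (mul_nonneg (hG0 U) (hwt0 U))]
    exact mul_le_mul (hGB U) (hwtC U) (hwt0 U) ((hG0 U).trans (hGB U))
  have hZ0 : 0 ≤ ∫ U, wt U ∂μ := integral_nonneg hwt0
  have hb0 : 0 ≤ ∫ U, G U * wt U ∂μ := integral_nonneg fun U => mul_nonneg (hG0 U) (hwt0 U)
  have key : L * ∫ U, F U * wt U ∂μ ≤ ∫ U, G U * wt U ∂μ := by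
    by_cases hint : Integrable (fun U => F U * wt U) μ
    · rw [← integral_const_mul]
      refine integral_mono (hint.const_mul L) hGwt_int fun U => ?_
      dsimp only
      rw [← mul_assoc]
      exact mul_le_mul_of_nonneg_right (hFG U) (hwt0 U)
    · rw [integral_undef hint, mul_zero]
      exact hb0
  have h1 : ∫ U, F U * wt U ∂μ ≤ (∫ U, G U * wt U ∂μ) / L := by
    rw [le_div_iff₀ hL]
    linarith [key]
  calc (∫ U, F U * wt U ∂μ) / (∫ U, wt U ∂μ)
      ≤ ((∫ U, G U * wt U ∂μ) / L) / (∫ U, wt U ∂μ) := div_le_div_of_nonneg_right h1 hZ0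
    _ = ((∫ U, G U * wt U ∂μ) / (∫ U, wt U ∂μ)) / L := by rw [div_right_comm]
    _ ≤ δ := by rw [div_le_iff₀ hL]; exact hbound

/-! ## Jensen law ⇒ mean-count law (fixed data) -/

/-- **Jensen law ⇒ mean-count law** at fixed `(reg, b₀, ℓ, m, R)`, same `δ`: for the radii `r_f` supplied by
the Jensen law, `log 2 · N_U ≤` the grid-summed two-circle excess pointwise
(`meanCount_log_two_mul_realSpecCount_le_gridSum`, cell by cell and flavour by flavour), the excess is
measurable, non-negative and bounded (`stub_excessRegular`), so `log 2 · E₊ N ≤ E₊ excess ≤ δ_j log 2`. -/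
theorem meanCountLaw_of_jensenLaw {Nf : ℕ} (reg : QCDRegularisation Nf) (b₀ : ℕ) (ℓ : ℝ) (m : Fin Nf → ℝ)
    (R : ℝ)
    (hJL : (∀ ε : ℝ, 0 < ε → ∀ᶠ k : ℕ in Filter.atTop, ∀ S : ℕ, R ≤ reg.a k * (2 * S + 1) →
          ∃ δ : ℕ → ℝ, (∀ j, 0 ≤ δ j) ∧
            ∑ j ∈ Finset.range (Nat.log 2 (⌊ℓ / reg.a k⌋₊ / b₀) + 1), δ j ≤ ε ∧
            ∀ j < Nat.log 2 (⌊ℓ / reg.a k⌋₊ / b₀) + 1, ∀ s : Fin 4 → ℕ,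
              (∀ i, b₀ * 2 ^ j ≤ s i ∧ s i < b₀ * 2 ^ (j + 2) ∧ s i ≤ 2 * S + 1 ∧
                (s i : ℝ) * reg.a k ≤ ℓ) →
              ∃ r : Fin Nf → ℝ, (∀ f, 0 < r f) ∧
                (∫ U, (∑ f, ∑ n ∈ Finset.range
                    (⌊(-(reg.mcrit k + reg.a k * m f / reg.Zm k)) / (2 * r f)⌋₊ + 1),
                    ((Real.circleAverage (fun z : ℂ => Real.log ‖((wilsonCell U 0 (0 : TorusSite 4 (2 * S + 1)) s).charpoly).eval z‖)
                        ((((2 * (n : ℝ) + 1) * r f : ℝ)) : ℂ) (2 * r f)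
                      - Real.circleAverage (fun z : ℂ => Real.log ‖((wilsonCell U 0 (0 : TorusSite 4 (2 * S + 1)) s).charpoly).eval z‖)
                        ((((2 * (n : ℝ) + 1) * r f : ℝ)) : ℂ) (r f)) +
                      ∑ ε : Fin 4 → Bool,
                        (Real.circleAverage (fun z : ℂ => Real.log ‖((wilsonCell U 0 (halfCorner s ε) (halfSides s ε)).charpoly).eval z‖)
                        ((((2 * (n : ℝ) + 1) * r f : ℝ)) : ℂ) (2 * r f)
                      - Real.circleAverage (fun z : ℂ => Real.log ‖((wilsonCell U 0 (halfCorner s ε) (halfSides s ε)).charpoly).eval z‖)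
                        ((((2 * (n : ℝ) + 1) * r f : ℝ)) : ℂ) (r f)))) *
                    (∏ f, ‖fermionDet (wilsonDirac (fundamentalRep (Fin 3)) U (reg.mcrit k + reg.a k * m f / reg.Zm k) 1)‖)
                  ∂(wilsonMeasure (fundamentalRep (Fin 3)) (reg.β k) : Measure (GaugeConfig 4 (2 * S + 1) (Matrix.specialUnitaryGroup (Fin 3) ℂ)))) /
                (∫ U, (∏ f, ‖fermionDet (wilsonDirac (fundamentalRep (Fin 3)) U (reg.mcrit k + reg.a k * m f / reg.Zm k) 1)‖)
                  ∂(wilsonMeasure (fundamentalRep (Fin 3)) (reg.β k) : Measure (GaugeConfig 4 (2 * S + 1) (Matrix.specialUnitaryGroup (Fin 3) ℂ))))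
              ≤ δ j * Real.log 2)) :
    (∀ ε : ℝ, 0 < ε → ∀ᶠ k : ℕ in Filter.atTop, ∀ S : ℕ, R ≤ reg.a k * (2 * S + 1) →
          ∃ δ : ℕ → ℝ, (∀ j, 0 ≤ δ j) ∧
            ∑ j ∈ Finset.range (Nat.log 2 (⌊ℓ / reg.a k⌋₊ / b₀) + 1), δ j ≤ ε ∧
            ∀ j < Nat.log 2 (⌊ℓ / reg.a k⌋₊ / b₀) + 1, ∀ s : Fin 4 → ℕ,
              (∀ i, b₀ * 2 ^ j ≤ s i ∧ s i < b₀ * 2 ^ (j + 2) ∧ s i ≤ 2 * S + 1 ∧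
                (s i : ℝ) * reg.a k ≤ ℓ) →
              (∫ U, (∑ f, ((realSpecCount (wilsonCell U 0 (0 : TorusSite 4 (2 * S + 1)) s) (-(reg.mcrit k + reg.a k * m f / reg.Zm k)) : ℝ) +
                    ∑ c : Fin 4 → Bool,
                      (realSpecCount (wilsonCell U 0 (halfCorner s c) (halfSides s c)) (-(reg.mcrit k + reg.a k * m f / reg.Zm k)) : ℝ))) *
                    (∏ f, ‖fermionDet (wilsonDirac (fundamentalRep (Fin 3)) U (reg.mcrit k + reg.a k * m f / reg.Zm k) 1)‖)
                  ∂(wilsonMeasure (fundamentalRep (Fin 3)) (reg.β k) : Measure (GaugeConfig 4 (2 * S + 1) (Matrix.specialUnitaryGroup (Fin 3) ℂ)))) /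
                (∫ U, (∏ f, ‖fermionDet (wilsonDirac (fundamentalRep (Fin 3)) U (reg.mcrit k + reg.a k * m f / reg.Zm k) 1)‖)
                  ∂(wilsonMeasure (fundamentalRep (Fin 3)) (reg.β k) : Measure (GaugeConfig 4 (2 * S + 1) (Matrix.specialUnitaryGroup (Fin 3) ℂ))))
              ≤ δ j) := by
  intro ε hε
  filter_upwards [hJL ε hε] with k hk
  intro S hS
  obtain ⟨δ, hδ0, hδs, hδ⟩ := hk S hS
  refine ⟨δ, hδ0, hδs, fun j hj s hs => ?_⟩
  obtain ⟨r, hr, hbound⟩ := hδ j hj s hs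
  have hr2 : ∀ f, 0 < 2 * r f := fun f => by linarith [hr f]
  have hrR : ∀ f, r f < 2 * r f := fun f => by linarith [hr f]
  have hlog2pos : 0 < Real.log 2 := Real.log_pos (by norm_num)
  -- the weight: continuous on a compact space, hence measurable, bounded, and it is non-negative
  have hwt_cont : Continuous fun U : GaugeConfig 4 (2 * S + 1) SU3 =>
      ∏ f, ‖fermionDet (wilsonDirac (fundamentalRep (Fin 3)) U
        (reg.mcrit k + reg.a k * m f / reg.Zm k) 1)‖ :=
    continuous_finsetProd _ fun f _ =>
      ((continuous_wilsonDirac (fundamentalRep (Fin 3)) (continuous_fundamentalRep (Fin 3)) _ _).matrix_det).norm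
  have hwt0 : ∀ U : GaugeConfig 4 (2 * S + 1) SU3,
      0 ≤ ∏ f, ‖fermionDet (wilsonDirac (fundamentalRep (Fin 3)) U
        (reg.mcrit k + reg.a k * m f / reg.Zm k) 1)‖ :=
    fun U => Finset.prod_nonneg fun f _ => norm_nonneg _
  obtain ⟨Cw, hCw⟩ : ∃ Cw : ℝ, ∀ U : GaugeConfig 4 (2 * S + 1) SU3,
      ∏ f, ‖fermionDet (wilsonDirac (fundamentalRep (Fin 3)) U
        (reg.mcrit k + reg.a k * m f / reg.Zm k) 1)‖ ≤ Cw := by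
    obtain ⟨U₀, -, hU₀⟩ := (isCompact_univ (X := GaugeConfig 4 (2 * S + 1) SU3)).exists_isMaxOn
      Set.univ_nonempty hwt_cont.continuousOn
    exact ⟨_, fun U => hU₀ (Set.mem_univ U)⟩
  -- the charge functional: measurable, non-negative, bounded (stub 2)
  have hJ := fun (x : TorusSite 4 (2 * S + 1)) (s' : Fin 4 → ℕ) (c : ℝ) (f : Fin Nf) =>
    stub_excessRegular (2 * S + 1) x s' c (r f) (2 * r f) (hr f) (hrR f)
  refine meanCount_ratio_le_of_charge
    (wilsonMeasure (d := 4) (L := 2 * S + 1) (fundamentalRep (Fin 3)) (reg.β k))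
    (fun U => ∏ f, ‖fermionDet (wilsonDirac (fundamentalRep (Fin 3)) U
      (reg.mcrit k + reg.a k * m f / reg.Zm k) 1)‖)
    (fun U => (∑ f, ((realSpecCount (wilsonCell U 0 0 s) (-(reg.mcrit k + reg.a k * m f / reg.Zm k)) : ℝ) +
                    ∑ c : Fin 4 → Bool,
                      (realSpecCount (wilsonCell U 0 (halfCorner s c) (halfSides s c)) (-(reg.mcrit k + reg.a k * m f / reg.Zm k)) : ℝ))))
    (fun U => (∑ f, ∑ n ∈ Finset.range
                    (⌊(-(reg.mcrit k + reg.a k * m f / reg.Zm k)) / (2 * r f)⌋₊ + 1),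
                    ((Real.circleAverage (fun z : ℂ => Real.log ‖((wilsonCell U 0 0 s).charpoly).eval z‖)
                        ((((2 * (n : ℝ) + 1) * r f : ℝ)) : ℂ) (2 * r f)
                      - Real.circleAverage (fun z : ℂ => Real.log ‖((wilsonCell U 0 0 s).charpoly).eval z‖)
                        ((((2 * (n : ℝ) + 1) * r f : ℝ)) : ℂ) (r f)) +
                      ∑ ε : Fin 4 → Bool,
                        (Real.circleAverage (fun z : ℂ => Real.log ‖((wilsonCell U 0 (halfCorner s ε) (halfSides s ε)).charpoly).eval z‖)
                        ((((2 * (n : ℝ) + 1) * r f : ℝ)) : ℂ) (2 * r f)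
                      - Real.circleAverage (fun z : ℂ => Real.log ‖((wilsonCell U 0 (halfCorner s ε) (halfSides s ε)).charpoly).eval z‖)
                        ((((2 * (n : ℝ) + 1) * r f : ℝ)) : ℂ) (r f)))))
    hwt_cont.measurable hwt0 Cw hCw ?_ ?_
    (∑ f, ∑ n ∈ Finset.range (⌊-(reg.mcrit k + reg.a k * m f / reg.Zm k) / (2 * r f)⌋₊ + 1),
      ((Fintype.card {p // wilsonBox (0 : TorusSite 4 (2 * S + 1)) s p} : ℝ) * Real.log (2 * r f / r f) +
        ∑ ε : Fin 4 → Bool,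
          (Fintype.card {p // wilsonBox (halfCorner s ε : TorusSite 4 (2 * S + 1)) (halfSides s ε) p} : ℝ) *
            Real.log (2 * r f / r f)))
    ?_ (Real.log 2) hlog2pos ?_ (δ j) hbound
  · -- measurability of the charge
    refine Finset.measurable_sum _ fun f _ => Finset.measurable_sum _ fun n _ => ?_
    refine Measurable.add (hJ 0 s _ f).1 (Finset.measurable_sum _ fun ε _ => ?_)
    exact (hJ (halfCorner s ε) (halfSides s ε) _ f).1
  · -- non-negativity of the charge
    intro U
    refine Finset.sum_nonneg fun f _ => Finset.sum_nonneg fun n _ => add_nonneg ?_ ?_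
    · exact ((hJ 0 s _ f).2 U).1
    · exact Finset.sum_nonneg fun ε _ => ((hJ (halfCorner s ε) (halfSides s ε) _ f).2 U).1
  · -- boundedness of the charge
    intro U
    refine Finset.sum_le_sum fun f _ => Finset.sum_le_sum fun n _ => add_le_add ?_ ?_
    · exact ((hJ 0 s _ f).2 U).2
    · exact Finset.sum_le_sum fun ε _ => ((hJ (halfCorner s ε) (halfSides s ε) _ f).2 U).2
  · -- pointwise: `log 2 · count ≤ charge`, cell by cell
    intro U
    rw [Finset.mul_sum]
    refine Finset.sum_le_sum fun f _ => ?_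
    rw [mul_add, Finset.mul_sum, Finset.sum_add_distrib]
    refine add_le_add (meanCount_log_two_mul_realSpecCount_le_gridSum U 0 s _ (hr f)) ?_
    rw [Finset.sum_comm]
    exact Finset.sum_le_sum fun c _ =>
      meanCount_log_two_mul_realSpecCount_le_gridSum U (halfCorner s c) (halfSides s c) _ (hr f)

/-! ## Mean-count law ⇒ clause (a′) (fixed data) -/

/-- **Mean-count law ⇒ clause (a′)** at fixed `(reg, b₀, ℓ, m, R)`, same `δ`: a cover event of (a′) (the
corner-`0` window cell or one of its children singular at a bare mass `μ' ≥ m_f(k)`) has `N_U ≥ 1`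
(`meanCount_one_le_realSpecCount`); the count is measurable (`meanCount_measurable_realSpecCount`),
non-negative and bounded by the total cell size, so Markov for the OUTER phase-quenched probability
(`outerProb_le_of_charge`, `L = 1`) gives `P₊(E) ≤ δ_j`. -/
theorem dilution_of_meanCountLaw {Nf : ℕ} (reg : QCDRegularisation Nf) (b₀ : ℕ) (ℓ : ℝ) (m : Fin Nf → ℝ)
    (R : ℝ)
    (hMC : (∀ ε : ℝ, 0 < ε → ∀ᶠ k : ℕ in Filter.atTop, ∀ S : ℕ, R ≤ reg.a k * (2 * S + 1) →
          ∃ δ : ℕ → ℝ, (∀ j, 0 ≤ δ j) ∧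
            ∑ j ∈ Finset.range (Nat.log 2 (⌊ℓ / reg.a k⌋₊ / b₀) + 1), δ j ≤ ε ∧
            ∀ j < Nat.log 2 (⌊ℓ / reg.a k⌋₊ / b₀) + 1, ∀ s : Fin 4 → ℕ,
              (∀ i, b₀ * 2 ^ j ≤ s i ∧ s i < b₀ * 2 ^ (j + 2) ∧ s i ≤ 2 * S + 1 ∧
                (s i : ℝ) * reg.a k ≤ ℓ) →
              (∫ U, (∑ f, ((realSpecCount (wilsonCell U 0 (0 : TorusSite 4 (2 * S + 1)) s) (-(reg.mcrit k + reg.a k * m f / reg.Zm k)) : ℝ) +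
                    ∑ c : Fin 4 → Bool,
                      (realSpecCount (wilsonCell U 0 (halfCorner s c) (halfSides s c)) (-(reg.mcrit k + reg.a k * m f / reg.Zm k)) : ℝ))) *
                    (∏ f, ‖fermionDet (wilsonDirac (fundamentalRep (Fin 3)) U (reg.mcrit k + reg.a k * m f / reg.Zm k) 1)‖)
                  ∂(wilsonMeasure (fundamentalRep (Fin 3)) (reg.β k) : Measure (GaugeConfig 4 (2 * S + 1) (Matrix.specialUnitaryGroup (Fin 3) ℂ)))) /
                (∫ U, (∏ f, ‖fermionDet (wilsonDirac (fundamentalRep (Fin 3)) U (reg.mcrit k + reg.a k * m f / reg.Zm k) 1)‖)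
                  ∂(wilsonMeasure (fundamentalRep (Fin 3)) (reg.β k) : Measure (GaugeConfig 4 (2 * S + 1) (Matrix.specialUnitaryGroup (Fin 3) ℂ))))
              ≤ δ j)) :
    (∀ ε : ℝ, 0 < ε → ∀ᶠ k : ℕ in Filter.atTop, ∀ S : ℕ, R ≤ reg.a k * (2 * S + 1) →
          ∃ δ : ℕ → ℝ, (∀ j, 0 ≤ δ j) ∧
            ∑ j ∈ Finset.range (Nat.log 2 (⌊ℓ / reg.a k⌋₊ / b₀) + 1), δ j ≤ ε ∧
            ∀ j < Nat.log 2 (⌊ℓ / reg.a k⌋₊ / b₀) + 1, ∀ s : Fin 4 → ℕ,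
              (∀ i, b₀ * 2 ^ j ≤ s i ∧ s i < b₀ * 2 ^ (j + 2) ∧ s i ≤ 2 * S + 1 ∧
                (s i : ℝ) * reg.a k ≤ ℓ) →
              ∀ E : GaugeConfig 4 (2 * S + 1) (Matrix.specialUnitaryGroup (Fin 3) ℂ) → Prop,
                (∀ U, E U → ∃ f : Fin Nf, ∃ μ' : ℝ, reg.mcrit k + reg.a k * m f / reg.Zm k ≤ μ' ∧
                  ((wilsonCell U μ' 0 s).det = 0 ∨
                    ∃ c : Fin 4 → Bool, (wilsonCell U μ' (halfCorner s c) (halfSides s c)).det = 0)) →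
                (∫ U, (if E U then (1 : ℝ) else 0) * (∏ f, ‖fermionDet (wilsonDirac (fundamentalRep (Fin 3)) U (reg.mcrit k + reg.a k * m f / reg.Zm k) 1)‖)
                  ∂(wilsonMeasure (fundamentalRep (Fin 3)) (reg.β k) : Measure (GaugeConfig 4 (2 * S + 1) (Matrix.specialUnitaryGroup (Fin 3) ℂ)))) /
                (∫ U, (∏ f, ‖fermionDet (wilsonDirac (fundamentalRep (Fin 3)) U (reg.mcrit k + reg.a k * m f / reg.Zm k) 1)‖)
                  ∂(wilsonMeasure (fundamentalRep (Fin 3)) (reg.β k) : Measure (GaugeConfig 4 (2 * S + 1) (Matrix.specialUnitaryGroup (Fin 3) ℂ)))) ≤ δ j) := by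
  intro ε hε
  filter_upwards [hMC ε hε] with k hk
  intro S hS
  obtain ⟨δ, hδ0, hδs, hδ⟩ := hk S hS
  refine ⟨δ, hδ0, hδs, ?_⟩
  intro j hj s hs E hE
  have hbound := hδ j hj s hs
  -- the weight: continuous on a compact space, hence measurable, bounded, and it is non-negative
  have hwt_cont : Continuous fun U : GaugeConfig 4 (2 * S + 1) SU3 =>
      ∏ f, ‖fermionDet (wilsonDirac (fundamentalRep (Fin 3)) U
        (reg.mcrit k + reg.a k * m f / reg.Zm k) 1)‖ :=
    continuous_finsetProd _ fun f _ =>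
      ((continuous_wilsonDirac (fundamentalRep (Fin 3)) (continuous_fundamentalRep (Fin 3)) _ _).matrix_det).norm
  have hwt0 : ∀ U : GaugeConfig 4 (2 * S + 1) SU3,
      0 ≤ ∏ f, ‖fermionDet (wilsonDirac (fundamentalRep (Fin 3)) U
        (reg.mcrit k + reg.a k * m f / reg.Zm k) 1)‖ :=
    fun U => Finset.prod_nonneg fun f _ => norm_nonneg _
  obtain ⟨Cw, hCw⟩ : ∃ Cw : ℝ, ∀ U : GaugeConfig 4 (2 * S + 1) SU3,
      ∏ f, ‖fermionDet (wilsonDirac (fundamentalRep (Fin 3)) U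
        (reg.mcrit k + reg.a k * m f / reg.Zm k) 1)‖ ≤ Cw := by
    obtain ⟨U₀, -, hU₀⟩ := (isCompact_univ (X := GaugeConfig 4 (2 * S + 1) SU3)).exists_isMaxOn
      Set.univ_nonempty hwt_cont.continuousOn
    exact ⟨_, fun U => hU₀ (Set.mem_univ U)⟩
  refine outerProb_le_of_charge
    (wilsonMeasure (d := 4) (L := 2 * S + 1) (fundamentalRep (Fin 3)) (reg.β k))
    (fun U => ∏ f, ‖fermionDet (wilsonDirac (fundamentalRep (Fin 3)) U
      (reg.mcrit k + reg.a k * m f / reg.Zm k) 1)‖)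
    (fun U => (∑ f, ((realSpecCount (wilsonCell U 0 0 s) (-(reg.mcrit k + reg.a k * m f / reg.Zm k)) : ℝ) +
                    ∑ c : Fin 4 → Bool,
                      (realSpecCount (wilsonCell U 0 (halfCorner s c) (halfSides s c)) (-(reg.mcrit k + reg.a k * m f / reg.Zm k)) : ℝ))))
    hwt_cont.measurable hwt0 Cw hCw ?_ ?_
    (∑ f : Fin Nf, ((Fintype.card {p // wilsonBox (0 : TorusSite 4 (2 * S + 1)) s p} : ℝ) +
        ∑ c : Fin 4 → Bool,
          (Fintype.card {p // wilsonBox (halfCorner s c : TorusSite 4 (2 * S + 1)) (halfSides s c) p} : ℝ)))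
    ?_ E 1 one_pos ?_ (δ j) (by rw [mul_one]; exact hbound)
  · -- measurability of the count
    refine Finset.measurable_sum _ fun f _ => ?_
    refine Measurable.add (meanCount_measurable_realSpecCount_real 0 s _)
      (Finset.measurable_sum _ fun c _ => ?_)
    exact meanCount_measurable_realSpecCount_real (halfCorner s c) (halfSides s c) _
  · -- non-negativity of the count
    intro U
    exact Finset.sum_nonneg fun f _ =>
      add_nonneg (Nat.cast_nonneg _) (Finset.sum_nonneg fun c _ => Nat.cast_nonneg _)
  · -- boundedness of the count (cell sizes)
    intro U
    refine Finset.sum_le_sum fun f _ => add_le_add ?_ (Finset.sum_le_sum fun c _ => ?_)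
    · exact_mod_cast realSpecCount_le_card _ _
    · exact_mod_cast realSpecCount_le_card _ _
  · -- every configuration of the cover event has at least one early crosser
    intro U hU
    obtain ⟨f, μ', hμ'v, hsing⟩ := hE U hU
    have hf : (1 : ℝ) ≤
        (realSpecCount (wilsonCell U 0 0 s) (-(reg.mcrit k + reg.a k * m f / reg.Zm k)) : ℝ) +
          ∑ c : Fin 4 → Bool,
            (realSpecCount (wilsonCell U 0 (halfCorner s c) (halfSides s c))
              (-(reg.mcrit k + reg.a k * m f / reg.Zm k)) : ℝ) := by
      rcases hsing with hpar | ⟨c₀, hchild⟩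
      · have h1 : (1 : ℝ) ≤
            (realSpecCount (wilsonCell U 0 0 s) (-(reg.mcrit k + reg.a k * m f / reg.Zm k)) : ℝ) := by
          exact_mod_cast meanCount_one_le_realSpecCount U 0 s hμ'v hpar
        exact le_add_of_le_of_nonneg h1 (Finset.sum_nonneg fun c _ => Nat.cast_nonneg _)
      · have h1 : (1 : ℝ) ≤
            (realSpecCount (wilsonCell U 0 (halfCorner s c₀) (halfSides s c₀))
              (-(reg.mcrit k + reg.a k * m f / reg.Zm k)) : ℝ) := by
          exact_mod_cast meanCount_one_le_realSpecCount U (halfCorner s c₀) (halfSides s c₀) hμ'v hchild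
        refine le_add_of_nonneg_of_le (Nat.cast_nonneg _) (h1.trans ?_)
        exact Finset.single_le_sum
          (f := fun c : Fin 4 → Bool =>
            (realSpecCount (wilsonCell U 0 (halfCorner s c) (halfSides s c))
              (-(reg.mcrit k + reg.a k * m f / reg.Zm k)) : ℝ))
          (fun c _ => Nat.cast_nonneg _) (Finset.mem_univ c₀)
    refine hf.trans ?_
    exact Finset.single_le_sum
      (f := fun f' : Fin Nf =>
        (realSpecCount (wilsonCell U 0 0 s) (-(reg.mcrit k + reg.a k * m f' / reg.Zm k)) : ℝ) +
          ∑ c : Fin 4 → Bool,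
            (realSpecCount (wilsonCell U 0 (halfCorner s c) (halfSides s c))
              (-(reg.mcrit k + reg.a k * m f' / reg.Zm k)) : ℝ))
      (fun f' _ => add_nonneg (Nat.cast_nonneg _) (Finset.sum_nonneg fun c _ => Nat.cast_nonneg _))
      (Finset.mem_univ f)

end Summit.QuantumFields.QCD.Cruxes.EarlyCrosserLaw.AccretiveCoarseJensen

end
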